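import Mathlib
import Summits.ValiantsHypothesis.ValiantsHypothesis.Theorems.NewtonUnitEquationsDissociatedUniformGenericWords

/-!
# Generic stratum of crux `DissociatedUniform` — the two menus of a top-`k` word

Crux stmt-ValiantsHypothesis-5905 (`NewtonUnitEquations.DissociatedUniform`), line `greedy-basis-shadow`, by-product
"generic stratum" (lead c5).  For a word `a` of the box with fewer than `k` words strictly above it (for a height `ψ`
comparison-equivalent to the height `φ` used in all definitions), two injective "menus" of words at least as high as `a`
give the product bounds
* `prod_card_U_le`:  `∏_j |U a j| ≤ k` (raise letters independently), and
* `prod_G_le`:  `∏_{j ∈ dem a} (|G a j| + 1) ≤ k` (undo the demotion at `j` and transfer it to the best demotion of a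
  coordinate of the gap `G a j` just below `j` in best-demotion order; the gaps are pairwise disjoint).
[folklore shape; the gap menu corrects the "greedy assignment" count of the crux notes]
-/

open scoped BigOperators

-- Sub = Summit single-conjunct layout: the duplicated namespace component is mandated by the tree.
set_option linter.dupNamespace false

namespace Summit.ValiantsHypothesis.ValiantsHypothesis.Theorems.NewtonUnitEquationsDissociatedUniform

namespace Generic

noncomputable section

variable {ι L : Type}

/-- Transport of a letter comparison inside one alphabet along comparison-equivalence. -/
theorem lt_iff_of_hc {A : ι → Finset L} {φ ψ : L → ℝ}
    (hc : ∀ (j j' : ι), ∀ l₁ ∈ A j, ∀ l₂ ∈ A j, ∀ l₃ ∈ A j', ∀ l₄ ∈ A j',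
      (φ l₁ - φ l₂ < φ l₃ - φ l₄ ↔ ψ l₁ - ψ l₂ < ψ l₃ - ψ l₄))
    {j : ι} {l l' : L} (hl : l ∈ A j) (hl' : l' ∈ A j) : (φ l < φ l' ↔ ψ l < ψ l') := by
  have h := hc j j l hl l' hl' l' hl' l' hl'
  simp only [sub_self, sub_neg] at h
  exact h

/-- Transport of `≤` inside one alphabet. -/
theorem le_iff_of_hc {A : ι → Finset L} {φ ψ : L → ℝ}
    (hc : ∀ (j j' : ι), ∀ l₁ ∈ A j, ∀ l₂ ∈ A j, ∀ l₃ ∈ A j', ∀ l₄ ∈ A j',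
      (φ l₁ - φ l₂ < φ l₃ - φ l₄ ↔ ψ l₁ - ψ l₂ < ψ l₃ - ψ l₄))
    {j : ι} {l l' : L} (hl : l ∈ A j) (hl' : l' ∈ A j) : (φ l ≤ φ l' ↔ ψ l ≤ ψ l') := by
  rw [← not_lt, ← not_lt, lt_iff_of_hc hc hl' hl]

section Umenu

variable [Fintype ι] [DecidableEq ι] [DecidableEq L]

/-- **First menu.**  If fewer than `k` words of the box are strictly `ψ`-higher than `a`, then `∏_j |U a j| ≤ k`
(the words with every letter at least as high as the corresponding letter of `a` are at least as high as `a`, and only `a`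
itself is not strictly higher). -/
theorem prod_card_U_le {A : ι → Finset L} {φ ψ : L → ℝ}
    (hc : ∀ (j j' : ι), ∀ l₁ ∈ A j, ∀ l₂ ∈ A j, ∀ l₃ ∈ A j', ∀ l₄ ∈ A j',
      (φ l₁ - φ l₂ < φ l₃ - φ l₄ ↔ ψ l₁ - ψ l₂ < ψ l₃ - ψ l₄))
    (hψ : Set.InjOn (Hw ψ) (Fintype.piFinset A : Set (ι → L))) {a : ι → L} (ha : a ∈ Fintype.piFinset A) {k : ℕ}
    (hk : ((Fintype.piFinset A).filter fun b => Hw ψ a < Hw ψ b).card < k) : ∏ j, (U A φ a j).card ≤ k := by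
  have ha' := Fintype.mem_piFinset.mp ha
  have hψA : ∀ j, Set.InjOn ψ (A j : Set L) := fun j => phi_injOn A ψ hψ ha j
  have hsub : Fintype.piFinset (U A φ a) ⊆ insert a ((Fintype.piFinset A).filter fun b => Hw ψ a < Hw ψ b) := by
    intro b hb
    have hb' := Fintype.mem_piFinset.mp hb
    have hbA : ∀ j, b j ∈ A j := fun j => (Finset.mem_filter.mp (hb' j)).1
    have hle : ∀ j, ψ (a j) ≤ ψ (b j) := fun j =>
      (le_iff_of_hc hc (ha' j) (hbA j)).mp (Finset.mem_filter.mp (hb' j)).2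
    have hbox : b ∈ Fintype.piFinset A := Fintype.mem_piFinset.mpr hbA
    have hsum : Hw ψ a ≤ Hw ψ b := Finset.sum_le_sum fun j _ => hle j
    rcases hsum.lt_or_eq with hlt | heq
    · exact Finset.mem_insert_of_mem (Finset.mem_filter.mpr ⟨hbox, hlt⟩)
    · refine Finset.mem_insert.mpr (Or.inl ?_)
      have hterm : ∀ j ∈ Finset.univ, ψ (a j) = ψ (b j) :=
        (Finset.sum_eq_sum_iff_of_le fun j _ => hle j).mp heq
      funext j
      exact (hψA j (Finset.mem_coe.mpr (hbA j)) (Finset.mem_coe.mpr (ha' j)) (hterm j (Finset.mem_univ j)).symm)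
  calc ∏ j, (U A φ a j).card = (Fintype.piFinset (U A φ a)).card := (Fintype.card_piFinset _).symm
    _ ≤ (insert a ((Fintype.piFinset A).filter fun b => Hw ψ a < Hw ψ b)).card := Finset.card_le_card hsub
    _ ≤ ((Fintype.piFinset A).filter fun b => Hw ψ a < Hw ψ b).card + 1 := Finset.card_insert_le _ _
    _ ≤ k := hk

end Umenu

section Gmenu

variable [Fintype ι] [DecidableEq ι] [Inhabited L] [DecidableEq L]

omit [DecidableEq ι] in
/-- Unfolding membership in a gap. -/
theorem mem_G {A : ι → Finset L} {φ : L → ℝ} {a : ι → L} {j c : ι} :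
    c ∈ G A φ a j ↔ ((A c).erase (top A φ c)).Nonempty ∧ bestw A φ c < bestw A φ j ∧
      ∀ j' ∈ dem A φ a, bestw A φ j' < bestw A φ j → bestw A φ j' < bestw A φ c := by
  simp [G]

omit [DecidableEq ι] in
/-- A gap coordinate is not demoted. -/
theorem not_mem_dem_of_mem_G {A : ι → Finset L} {φ : L → ℝ} {a : ι → L} {j c : ι} (hc : c ∈ G A φ a j) :
    c ∉ dem A φ a := fun hcd =>
  lt_irrefl _ ((mem_G.mp hc).2.2 c hcd (mem_G.mp hc).2.1)

/-- Gaps of distinct demoted coordinates are disjoint. -/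
theorem eq_of_mem_G_of_mem_G {A : ι → Finset L} {φ : L → ℝ} (hinj : Set.InjOn (Hw φ) (Fintype.piFinset A : Set (ι → L)))
    (hne : ∀ j, (A j).Nonempty) {a : ι → L} (ha : a ∈ Fintype.piFinset A) {j j' c : ι} (hj : j ∈ dem A φ a)
    (hj' : j' ∈ dem A φ a) (hc : c ∈ G A φ a j) (hc' : c ∈ G A φ a j') : j = j' := by
  rcases lt_trichotomy (bestw A φ j) (bestw A φ j') with hlt | heq | hgt
  · exact absurd (((mem_G.mp hc').2.2 j hj hlt).trans (mem_G.mp hc).2.1) (lt_irrefl _)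
  · exact bestw_injOn_big hinj hne (dem_subset_big A φ ha j hj) heq
  · exact absurd (((mem_G.mp hc).2.2 j' hj' hgt).trans (mem_G.mp hc').2.1) (lt_irrefl _)

/-- The cardinality of the menu is the gap product. -/
theorem card_menu (A : ι → Finset L) (φ : L → ℝ) (a : ι → L) :
    (menu A φ a).card = ∏ j ∈ dem A φ a, ((G A φ a j).card + 1) := by
  unfold menu
  rw [Fintype.card_piFinset, ← Finset.prod_filter_mul_prod_filter_not Finset.univ (fun j => j ∈ dem A φ a)]
  have h1 : ∏ j ∈ Finset.univ.filter (fun j => j ∈ dem A φ a),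
      (if j ∈ dem A φ a then Finset.insertNone (G A φ a j) else {none}).card = ∏ j ∈ dem A φ a, ((G A φ a j).card + 1) := by
    refine Finset.prod_congr (by ext j; simp) fun j hj => ?_
    rw [if_pos hj, Finset.card_insertNone]
  have h2 : ∏ j ∈ Finset.univ.filter (fun j => ¬ j ∈ dem A φ a),
      (if j ∈ dem A φ a then Finset.insertNone (G A φ a j) else {none}).card = 1 :=
    Finset.prod_eq_one fun j hj => by rw [if_neg (Finset.mem_filter.mp hj).2, Finset.card_singleton]
  rw [h1, h2, mul_one]

variable {A : ι → Finset L} {φ : L → ℝ} {a : ι → L}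

/-- Choices vanish off the demoted set. -/
theorem menu_none {g : ι → Option ι} (hg : g ∈ menu A φ a) {i : ι} (hi : i ∉ dem A φ a) : g i = none := by
  have := Fintype.mem_piFinset.mp hg i
  rw [if_neg hi] at this
  exact Finset.mem_singleton.mp this

/-- A chosen coordinate lies in the gap of the chooser, which is demoted. -/
theorem menu_some {g : ι → Option ι} (hg : g ∈ menu A φ a) {j c : ι} (h : g j = some c) :
    j ∈ dem A φ a ∧ c ∈ G A φ a j := by
  have hj : j ∈ dem A φ a := by
    by_contra hj
    rw [menu_none hg hj] at h
    cases h
  have := Fintype.mem_piFinset.mp hg j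
  rw [if_pos hj, h] at this
  exact ⟨hj, Finset.some_mem_insertNone.mp this⟩

/-- Menu words lie in the box. -/
theorem W_mem_box (hne : ∀ j, (A j).Nonempty) (ha : a ∈ Fintype.piFinset A) (g : ι → Option ι) :
    W A φ a g ∈ Fintype.piFinset A := by
  refine Fintype.mem_piFinset.mpr fun i => ?_
  unfold W
  split_ifs
  · exact top_mem A φ (hne i)
  · exact sec_mem A φ (hne i)
  · exact Fintype.mem_piFinset.mp ha i

/-- The value of a menu word at a choosing coordinate. -/
theorem W_of_ne_none {g : ι → Option ι} {i : ι} (h : g i ≠ none) : W A φ a g i = top A φ i := by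
  unfold W; rw [if_pos h]

/-- The value of a menu word at a chosen coordinate. -/
theorem W_of_chosen {g : ι → Option ι} {i : ι} (h0 : g i = none) (h : ∃ j, g j = some i) : W A φ a g i = sec A φ i := by
  unfold W; rw [if_neg (not_not.mpr h0), if_pos h]

/-- The value of a menu word elsewhere. -/
theorem W_of_neither {g : ι → Option ι} {i : ι} (h0 : g i = none) (h : ¬ ∃ j, g j = some i) : W A φ a g i = a i := by
  unfold W; rw [if_neg (not_not.mpr h0), if_neg h]

/-- A chosen coordinate of an admissible choice does not itself choose. -/
theorem menu_none_of_chosen {g : ι → Option ι} (hg : g ∈ menu A φ a) {j c : ι} (h : g j = some c) : g c = none :=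
  menu_none hg (not_mem_dem_of_mem_G (menu_some hg h).2)

/-- **Injectivity of the gap menu.** -/
theorem W_injOn (hinj : Set.InjOn (Hw φ) (Fintype.piFinset A : Set (ι → L))) (hne : ∀ j, (A j).Nonempty)
    (ha : a ∈ Fintype.piFinset A) : Set.InjOn (W A φ a) (menu A φ a : Set (ι → Option ι)) := by
  intro g hg g' hg' hW
  have hg : g ∈ menu A φ a := Finset.mem_coe.mp hg
  have hg' : g' ∈ menu A φ a := Finset.mem_coe.mp hg'
  have hφA : ∀ j, Set.InjOn φ (A j : Set L) := fun j => phi_injOn A φ hinj ha j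
  -- a choosing coordinate of `g` is a choosing coordinate of `g'`
  have key1 : ∀ {g g' : ι → Option ι}, g ∈ menu A φ a → g' ∈ menu A φ a → W A φ a g = W A φ a g' →
      ∀ j, g j ≠ none → g' j ≠ none := by
    intro g g' hg hg' hW j hj hj'
    have hjd : j ∈ dem A φ a := by
      obtain ⟨c, hc⟩ := Option.ne_none_iff_exists'.mp hj
      exact (menu_some hg hc).1
    have h1 : W A φ a g j = top A φ j := W_of_ne_none hj
    -- under `g'`, `j` is not chosen (chosen coordinates are not demoted), so `W g' j = a j ≠ top j`
    have hnc : ¬ ∃ j₀, g' j₀ = some j := fun ⟨j₀, hj₀⟩ => not_mem_dem_of_mem_G (menu_some hg' hj₀).2 hjd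
    have h2 : W A φ a g' j = a j := W_of_neither hj' hnc
    rw [hW, h2] at h1
    exact (mem_dem A φ).mp hjd h1
  -- a chosen coordinate of `g` (by `j`) is chosen by the same `j` under `g'`
  have key2 : ∀ {g g' : ι → Option ι}, g ∈ menu A φ a → g' ∈ menu A φ a → W A φ a g = W A φ a g' →
      ∀ j c, g j = some c → g' j = some c := by
    intro g g' hg hg' hW j c hjc
    have hc0 : g c = none := menu_none_of_chosen hg hjc
    have hWc : W A φ a g c = sec A φ c := W_of_chosen hc0 ⟨j, hjc⟩
    have hcG := (menu_some hg hjc).2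
    have hcbig := (mem_G.mp hcG).1
    -- under `g'`, `c` does not choose (it is not demoted) and `W g' c = sec c ≠ a c = top c`, so `c` is chosen
    have hc0' : g' c = none := menu_none hg' (not_mem_dem_of_mem_G hcG)
    have hchosen' : ∃ j₀, g' j₀ = some c := by
      by_contra hno
      have h3 : W A φ a g' c = a c := W_of_neither hc0' hno
      have hac : a c = top A φ c := by
        by_contra hne'
        exact not_mem_dem_of_mem_G hcG ((mem_dem A φ).mpr hne')
      rw [hW, h3, hac] at hWc
      exact sec_ne_top A φ hcbig hWc.symm
    obtain ⟨j₀, hj₀⟩ := hchosen'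
    have hsame : j₀ = j :=
      eq_of_mem_G_of_mem_G hinj hne ha (menu_some hg' hj₀).1 (menu_some hg hjc).1 (menu_some hg' hj₀).2 hcG
    rw [← hsame]; exact hj₀
  funext j
  rcases h : g j with _ | c
  · by_contra h'
    exact key1 hg' hg hW.symm j (fun h'' => h' h''.symm) h
  · exact (key2 hg hg' hW j c h).symm

/-- **Height of a menu word.**  With `J` the choosing coordinates and `c j` the choice,
`Hw ψ (W g) = Hw ψ a + Σ_{j ∈ J} ((ψ top_j - ψ a_j) - (ψ top_{c j} - ψ sec_{c j}))`. -/
theorem Hw_W_eq (hinj : Set.InjOn (Hw φ) (Fintype.piFinset A : Set (ι → L))) (hne : ∀ j, (A j).Nonempty)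
    (ha : a ∈ Fintype.piFinset A) (ψ : L → ℝ) {g : ι → Option ι} (hg : g ∈ menu A φ a) :
    Hw ψ (W A φ a g) = Hw ψ a + ∑ j ∈ Finset.univ.filter (fun j => g j ≠ none),
      ((ψ (top A φ j) - ψ (a j)) - (ψ (top A φ ((g j).getD j)) - ψ (sec A φ ((g j).getD j)))) := by
  set J := Finset.univ.filter (fun j => g j ≠ none) with hJ
  set C := Finset.univ.filter (fun i => g i = none ∧ ∃ j, g j = some i) with hC
  have hF : ∀ i, i ∉ J ∪ C → ψ (W A φ a g i) - ψ (a i) = 0 := by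
    intro i hi
    rw [Finset.mem_union, not_or, hJ, hC, Finset.mem_filter, Finset.mem_filter] at hi
    have h0 : g i = none := by by_contra h; exact hi.1 ⟨Finset.mem_univ _, h⟩
    have hno : ¬ ∃ j, g j = some i := fun h => hi.2 ⟨Finset.mem_univ _, h0, h⟩
    rw [W_of_neither h0 hno, sub_self]
  have hdisj : Disjoint J C := by
    rw [Finset.disjoint_left]
    intro i hiJ hiC
    exact (Finset.mem_filter.mp hiJ).2 (Finset.mem_filter.mp hiC).2.1
  have hdiff : Hw ψ (W A φ a g) - Hw ψ a = ∑ i ∈ J ∪ C, (ψ (W A φ a g i) - ψ (a i)) := by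
    unfold Hw
    rw [← Finset.sum_sub_distrib]
    exact (Finset.sum_subset (Finset.subset_univ _) fun i _ hi => hF i hi).symm
  -- the chosen set is the image of the choosing set under the choice
  have hCimg : C = J.image fun j => (g j).getD j := by
    ext i
    simp only [hC, hJ, Finset.mem_filter, Finset.mem_univ, true_and, Finset.mem_image]
    constructor
    · rintro ⟨_, j, hj⟩
      exact ⟨j, by rw [hj]; exact Option.some_ne_none _, by rw [hj]; rfl⟩
    · rintro ⟨j, hj, rfl⟩
      obtain ⟨c, hc⟩ := Option.ne_none_iff_exists'.mp hj
      rw [hc]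
      exact ⟨menu_none_of_chosen hg hc, j, hc⟩
  have hcinj : Set.InjOn (fun j => (g j).getD j) (J : Set ι) := by
    intro j hj j' hj' hjj'
    have hj := (Finset.mem_filter.mp (Finset.mem_coe.mp hj)).2
    have hj' := (Finset.mem_filter.mp (Finset.mem_coe.mp hj')).2
    obtain ⟨c, hc⟩ := Option.ne_none_iff_exists'.mp hj
    obtain ⟨c', hc'⟩ := Option.ne_none_iff_exists'.mp hj'
    simp only [hc, hc', Option.getD_some] at hjj'
    subst hjj'
    exact eq_of_mem_G_of_mem_G hinj hne ha (menu_some hg hc).1 (menu_some hg hc').1 (menu_some hg hc).2 (menu_some hg hc').2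
  have hsumC : ∑ i ∈ C, (ψ (W A φ a g i) - ψ (a i)) =
      ∑ j ∈ J, (ψ (sec A φ ((g j).getD j)) - ψ (top A φ ((g j).getD j))) := by
    rw [hCimg, Finset.sum_image hcinj]
    refine Finset.sum_congr rfl fun j hj => ?_
    have hj := (Finset.mem_filter.mp hj).2
    obtain ⟨c, hc⟩ := Option.ne_none_iff_exists'.mp hj
    simp only [hc, Option.getD_some]
    have hc0 : g c = none := menu_none_of_chosen hg hc
    have hcnd : c ∉ dem A φ a := not_mem_dem_of_mem_G (menu_some hg hc).2
    have hac : a c = top A φ c := by by_contra h; exact hcnd ((mem_dem A φ).mpr h)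
    rw [W_of_chosen hc0 ⟨j, hc⟩, hac]
  have hsumJ : ∑ i ∈ J, (ψ (W A φ a g i) - ψ (a i)) = ∑ j ∈ J, (ψ (top A φ j) - ψ (a j)) :=
    Finset.sum_congr rfl fun j hj => by rw [W_of_ne_none (Finset.mem_filter.mp hj).2]
  rw [Finset.sum_union hdisj, hsumJ, hsumC, ← Finset.sum_add_distrib] at hdiff
  have : Hw ψ (W A φ a g) = Hw ψ a + (Hw ψ (W A φ a g) - Hw ψ a) := by ring
  rw [this, hdiff]
  congr 1
  exact Finset.sum_congr rfl fun j _ => by ring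

/-- **Second menu.**  If fewer than `k` words of the box are strictly `ψ`-higher than `a` (`ψ` comparison-equivalent to
`φ`), then `∏_{j ∈ dem a} (|G a j| + 1) ≤ k`. -/
theorem prod_G_le {ψ : L → ℝ}
    (hc : ∀ (j j' : ι), ∀ l₁ ∈ A j, ∀ l₂ ∈ A j, ∀ l₃ ∈ A j', ∀ l₄ ∈ A j',
      (φ l₁ - φ l₂ < φ l₃ - φ l₄ ↔ ψ l₁ - ψ l₂ < ψ l₃ - ψ l₄))
    (hinj : Set.InjOn (Hw φ) (Fintype.piFinset A : Set (ι → L))) (hne : ∀ j, (A j).Nonempty)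
    (ha : a ∈ Fintype.piFinset A) {k : ℕ} (hk : ((Fintype.piFinset A).filter fun b => Hw ψ a < Hw ψ b).card < k) :
    ∏ j ∈ dem A φ a, ((G A φ a j).card + 1) ≤ k := by
  have ha' := Fintype.mem_piFinset.mp ha
  have hφA : ∀ j, Set.InjOn φ (A j : Set L) := fun j => phi_injOn A φ hinj ha j
  -- every term of the height difference is positive
  have hterm : ∀ g ∈ menu A φ a, ∀ j, g j ≠ none →
      0 < (ψ (top A φ j) - ψ (a j)) - (ψ (top A φ ((g j).getD j)) - ψ (sec A φ ((g j).getD j))) := by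
    intro g hg j hj
    obtain ⟨c, hgc⟩ := Option.ne_none_iff_exists'.mp hj
    simp only [hgc, Option.getD_some]
    have hjd := (menu_some hg hgc).1
    have hcG := (menu_some hg hgc).2
    have hφlt : φ (top A φ c) - φ (sec A φ c) < φ (top A φ j) - φ (a j) :=
      lt_of_lt_of_le (mem_G.mp hcG).2.1 (bestw_le_weight (ha' j) ((mem_dem A φ).mp hjd))
    have hψlt := (hc c j _ (top_mem A φ (hne c)) _ (sec_mem A φ (hne c)) _ (top_mem A φ (hne j)) _ (ha' j)).mp hφlt
    linarith
  have hsub : (menu A φ a).image (W A φ a) ⊆ insert a ((Fintype.piFinset A).filter fun b => Hw ψ a < Hw ψ b) := by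
    intro b hb
    obtain ⟨g, hg, rfl⟩ := Finset.mem_image.mp hb
    by_cases hJ : (Finset.univ.filter fun j => g j ≠ none) = ∅
    · -- no choice: the word is `a`
      refine Finset.mem_insert.mpr (Or.inl ?_)
      funext i
      have h0 : g i = none := by
        by_contra h
        have : i ∈ Finset.univ.filter (fun j => g j ≠ none) := Finset.mem_filter.mpr ⟨Finset.mem_univ _, h⟩
        rw [hJ] at this
        exact Finset.notMem_empty _ this
      have hno : ¬ ∃ j, g j = some i := by
        rintro ⟨j, hj⟩
        have : j ∈ Finset.univ.filter (fun j => g j ≠ none) :=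
          Finset.mem_filter.mpr ⟨Finset.mem_univ _, by rw [hj]; exact Option.some_ne_none _⟩
        rw [hJ] at this
        exact Finset.notMem_empty _ this
      exact W_of_neither h0 hno
    · refine Finset.mem_insert_of_mem (Finset.mem_filter.mpr ⟨W_mem_box hne ha g, ?_⟩)
      rw [Hw_W_eq hinj hne ha ψ hg]
      have hpos : 0 < ∑ j ∈ Finset.univ.filter (fun j => g j ≠ none),
          ((ψ (top A φ j) - ψ (a j)) - (ψ (top A φ ((g j).getD j)) - ψ (sec A φ ((g j).getD j)))) :=
        Finset.sum_pos (fun j hj => hterm g hg j (Finset.mem_filter.mp hj).2) (Finset.nonempty_iff_ne_empty.mpr hJ)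
      linarith
  calc ∏ j ∈ dem A φ a, ((G A φ a j).card + 1) = (menu A φ a).card := (card_menu A φ a).symm
    _ = ((menu A φ a).image (W A φ a)).card := (Finset.card_image_of_injOn (W_injOn hinj hne ha)).symm
    _ ≤ (insert a ((Fintype.piFinset A).filter fun b => Hw ψ a < Hw ψ b)).card := Finset.card_le_card hsub
    _ ≤ ((Fintype.piFinset A).filter fun b => Hw ψ a < Hw ψ b).card + 1 := Finset.card_insert_le _ _
    _ ≤ k := hk

end Gmenu

end

end Generic

/-- **Registered sub-goal (file `GenericMenus`).**  The gap product of a top-`k` word is at most `k`. -/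
theorem generic_prod_G_le {ι L : Type} [Fintype ι] [DecidableEq ι] [Inhabited L] [DecidableEq L] (A : ι → Finset L) (φ ψ : L → ℝ) (hc : ∀ (j j' : ι), ∀ l₁ ∈ A j, ∀ l₂ ∈ A j, ∀ l₃ ∈ A j', ∀ l₄ ∈ A j', (φ l₁ - φ l₂ < φ l₃ - φ l₄ ↔ ψ l₁ - ψ l₂ < ψ l₃ - ψ l₄)) (hinj : Set.InjOn (Generic.Hw φ) (Fintype.piFinset A : Set (ι → L))) (hne : ∀ j, (A j).Nonempty) {a : ι → L} (ha : a ∈ Fintype.piFinset A) {k : ℕ} (hk : ((Fintype.piFinset A).filter fun b => Generic.Hw ψ a < Generic.Hw ψ b).card < k) : ∏ j ∈ Generic.dem A φ a, ((Generic.G A φ a j).card + 1) ≤ k :=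
  Generic.prod_G_le hc hinj hne ha hk

end Summit.ValiantsHypothesis.ValiantsHypothesis.Theorems.NewtonUnitEquationsDissociatedUniform
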